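import Summits.AnomalousDissipation.AnomalousDissipation.Theorems.QuarticGate.Negative.LevelCeiling
import Summits.AnomalousDissipation.AnomalousDissipation.Theorems.CubicParityLoud.Negative.EnergyRow

/-!
# Negative knowledge for the crux `MomentParity.QuarticGate` (stmt-AnomalousDissipation-11464):
# load-bearing analysis II — energy row, force floor, refuted strengthenings, shape of a refutation

Supports stmt-AnomalousDissipation-11464; no positive route-item statement is asserted. The analytic core
(the ENERGY ROW `ensembleDissipation ν μ = ∫ (u,f) dμ` of a level-`N` law whose quadratic frame test
`Σ(u,g_{kjc})²` is drift-free, and the power ceiling `∫(u,f)dμ ≤ ‖f‖₂ √(ensembleEnergy μ)`) is REUSED from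
the sibling crux's negative file `Theorems/CubicParityLoud/Negative/EnergyRow.lean`
(refuter-cdisprove-stmt-AnomalousDissipation-11465-0); it was derived independently, self-contained, in §C of
this seat's work file `Cruxes/QuarticGate/Disproof.lean` (refuter-cdisprove-stmt-AnomalousDissipation-11464-0).

* `IsPolyStationary.isStationary3` — `d`-stationarity (`d ≥ 3`) of `QuarticGate`'s vocabulary gives the
  sibling's `IsStationary3` (the clauses are verbatim the same sub-terms of the route file).
* `ensembleDissipation_eq_of_polyStationary`, `ensembleDissipation_le_of_polyStationary` — energy row and
  force floor for polynomially `d`-stationary level-`N` laws, `d ≥ 3`.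
* `IsQuarticWitness.eps_le_force` — `ε ≤ ‖f‖₂ √E` for every witness of `QuarticGate`.
* `not_quarticGateEveryForce` — the `∀ f` strengthening is FALSE (`f = 0` is quiet at every order).
* `not_quarticGateSubFloor` — the strengthening with `‖f‖₂ √E < ε` is FALSE.
* `not_quarticGate_iff` — a refutation of the crux is a uniform-in-`N` quietness theorem; `CubicShadow`,
  `cubicShadow_of_quarticGate` — the order-3 shadow any cheap kill would already have to kill.
-/

namespace Summit.AnomalousDissipation.AnomalousDissipation.Theorems.QuarticGate.Negative

open MeasureTheory Filter Topology
open scoped ENNReal InnerProductSpace RealInnerProductSpace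
open Literature.Analysis.FunctionSpaces Literature.Analysis.FluidPDE
open Summit.AnomalousDissipation.AnomalousDissipation.Theses.MomentParity

noncomputable section

/-! ## C. Energy row and force floor (via the sibling crux's certified energy row) -/

section EnergyRow

/-- `d`-stationarity (`3 ≤ d`) in `QuarticGate`'s vocabulary is the sibling crux's 3-stationarity
(same verbatim clauses). [folklore] -/
theorem IsPolyStationary.isStationary3 {ν : ℝ} {f : UnitAddTorus (Fin 3) → EuclideanSpace ℝ (Fin 3)}
    {N d : ℕ} {μ : Measure (Torus.energySpace (Fin 3))} (h : IsPolyStationary ν f N d μ) (hd : 3 ≤ d) :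
    CubicParityLoud.Negative.IsStationary3 ν f N μ :=
  fun m g P hg hP => h m g P hg (hP.trans hd)

/-- On a finite measure, `‖u‖²` integrable ⇒ `‖u‖` integrable. [folklore] -/
theorem integrable_norm_of_norm_sq {μ : Measure (Torus.energySpace (Fin 3))} [IsFiniteMeasure μ]
    (h2 : Integrable (fun u : Torus.energySpace (Fin 3) => ‖u‖ ^ 2) μ) :
    Integrable (fun u : Torus.energySpace (Fin 3) => ‖u‖) μ :=
  ((memLp_two_iff_integrable_sq continuous_norm.aestronglyMeasurable).2 h2).integrable one_le_two

/-- **Dissipation = mean injection** for a polynomially `d`-stationary (`d ≥ 3`) level-`N` law with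
finite mean energy: `ensembleDissipation ν μ = ∫ (u, f) dμ` (the quadratic frame test; sibling file). [folklore] -/
theorem ensembleDissipation_eq_of_polyStationary {ν : ℝ}
    (f : UnitAddTorus (Fin 3) → EuclideanSpace ℝ (Fin 3))
    (hf : MemLp f 2 volume) {N : ℕ} {μ : Measure (Torus.energySpace (Fin 3))} [IsFiniteMeasure μ]
    (hlev : ∀ᵐ u ∂μ, IsLevel N u)
    (h2 : Integrable (fun u : Torus.energySpace (Fin 3) => ‖u‖ ^ 2) μ) {d : ℕ} (hd : 3 ≤ d)
    (hstat : IsPolyStationary ν f N d μ) :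
    Torus.ensembleDissipation ν μ = ∫ u, Torus.pairing u.1 f ∂μ :=
  CubicParityLoud.Negative.ensembleDissipation_eq_of_isStationary3 hf (hlev.mono fun _ hu => hu)
    (integrable_norm_of_norm_sq h2) (hstat.isStationary3 hd)

/-- **FORCE FLOOR**: a polynomially `d`-stationary (`d ≥ 3`) level-`N` probability law with finite mean
energy has `ensembleDissipation ν μ ≤ ‖f‖_{L²} · (ensembleEnergy μ)^{1/2}`. [folklore] -/
theorem ensembleDissipation_le_of_polyStationary {ν : ℝ}
    (f : UnitAddTorus (Fin 3) → EuclideanSpace ℝ (Fin 3))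
    (hf : MemLp f 2 volume) {N : ℕ} {μ : Measure (Torus.energySpace (Fin 3))} [IsProbabilityMeasure μ]
    (hlev : ∀ᵐ u ∂μ, IsLevel N u)
    (h2 : Integrable (fun u : Torus.energySpace (Fin 3) => ‖u‖ ^ 2) μ) {d : ℕ} (hd : 3 ≤ d)
    (hstat : IsPolyStationary ν f N d μ) :
    Torus.ensembleDissipation ν μ ≤ Real.sqrt (∫ x, ‖f x‖ ^ 2) * Real.sqrt (Torus.ensembleEnergy μ) := by
  rw [ensembleDissipation_eq_of_polyStationary f hf hlev h2 hd hstat]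
  exact CubicParityLoud.Negative.integral_pairing_le hf h2

/-- **Force floor for witnesses**: `ε ≤ ‖f‖_{L²} √E` for every level-`N` witness of `QuarticGate`
with an `L²` force (stationarity is used ONLY through the one quadratic energy test). [folklore] -/
theorem IsQuarticWitness.eps_le_force {f : UnitAddTorus (Fin 3) → EuclideanSpace ℝ (Fin 3)}
    (hf : MemLp f 2 volume) {ν : ℝ} {N : ℕ} {E ε : ℝ} {μ : Measure (Torus.energySpace (Fin 3))}
    (h : IsQuarticWitness f ν N E ε μ) : ε ≤ Real.sqrt (∫ x, ‖f x‖ ^ 2) * Real.sqrt E := by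
  obtain ⟨hprob, hlev, h4, hstat, hEn, hε⟩ := h
  have h2 := integrable_norm_sq_of_norm_pow_four h4
  calc ε ≤ Torus.ensembleDissipation ν μ := hε
    _ ≤ Real.sqrt (∫ x, ‖f x‖ ^ 2) * Real.sqrt (Torus.ensembleEnergy μ) :=
        ensembleDissipation_le_of_polyStationary f hf hlev h2 (le_refl 3)
          (fun m g P hg hP => hstat m g P hg (hP.trans (by norm_num)))
    _ ≤ Real.sqrt (∫ x, ‖f x‖ ^ 2) * Real.sqrt E := by gcongr

/-- NATURAL STRENGTHENING 2 (refuted): `QuarticGate` for EVERY admissible force (the quantifier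
pattern of `CubicParityLoud`, without its `f ≠ 0`). -/
def QuarticGateEveryForce : Prop :=
  ∀ f : UnitAddTorus (Fin 3) → EuclideanSpace ℝ (Fin 3),
    Torus.IsSmooth f → Torus.IsDivFree f → Torus.HasZeroMean f →
    ∃ (ν : ℕ → ℝ) (E ε : ℝ), (∀ j, 0 < ν j) ∧ Tendsto ν atTop (𝓝 0) ∧ 0 < ε ∧
    ∀ j : ℕ, ∃ᶠ N in atTop, ∃ μ, IsQuarticWitness f (ν j) N E ε μ

/-- **`¬ QuarticGateEveryForce`**: the zero force is quiet at every order (`ε ≤ ‖0‖ √E = 0`). The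
`∃ f` of the crux is load-bearing and the witness force must satisfy `‖f‖_{L²} ≥ ε/√E`. [folklore] -/
theorem not_quarticGateEveryForce : ¬ QuarticGateEveryForce := by
  intro h
  have hzero : (Torus.realTrigPoly (∅ : Finset (Fin 3 → ℤ)) (0 : (Fin 3 → ℤ) → EuclideanSpace ℂ (Fin 3)))
      = fun _ => 0 := Torus.realTrigPoly_zero ∅
  obtain ⟨ν, E, ε, hν, -, hε, hj⟩ := h (fun _ => 0) (Torus.isSmooth_const _)
    (by rw [← hzero]; exact Torus.isDivFree_realTrigPoly fun k hk => by simp at hk)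
    (by simp [Torus.HasZeroMean])
  obtain ⟨N, μ, hμ⟩ := (hj 0).exists
  have := hμ.eps_le_force (memLp_const 0)
  simp at this
  linarith

/-- NATURAL STRENGTHENING 3 (refuted): `QuarticGate` with an energy budget below the force floor,
`‖f‖_{L²} √E < ε`. -/
def QuarticGateSubFloor : Prop :=
  ∃ f : UnitAddTorus (Fin 3) → EuclideanSpace ℝ (Fin 3),
    Torus.IsSmooth f ∧ Torus.IsDivFree f ∧ Torus.HasZeroMean f ∧
    ∃ (ν : ℕ → ℝ) (E ε : ℝ), (∀ j, 0 < ν j) ∧ Tendsto ν atTop (𝓝 0) ∧ 0 < ε ∧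
    Real.sqrt (∫ x, ‖f x‖ ^ 2) * Real.sqrt E < ε ∧
    ∀ j : ℕ, ∃ᶠ N in atTop, ∃ μ, IsQuarticWitness f (ν j) N E ε μ

/-- **`¬ QuarticGateSubFloor`**: by the energy row, `ε ≤ ‖f‖_{L²}√E` for every witness. Tight: the
laminar Kolmogorov Dirac family of `Negative/Laminar.lean` attains it. [folklore] -/
theorem not_quarticGateSubFloor : ¬ QuarticGateSubFloor := by
  rintro ⟨f, hfs, -, -, ν, E, ε, hν, -, hε, hlt, hj⟩
  obtain ⟨N, μ, hμ⟩ := (hj 0).exists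
  have := hμ.eps_le_force (hfs.memLp 2)
  linarith

end EnergyRow

/-! ## E. What a refutation must prove, and the order-3 shadow -/

section Shape

/-- **`¬ QuarticGate` unfolded**: a refutation is a UNIFORM-IN-`N` QUIETNESS THEOREM — for every
admissible force, every positive `ν_j → 0` and all budgets `E`, `ε > 0`, some viscosity `ν_j` admits,
for all but finitely many levels `N`, no loud 4-stationary level-`N` law. (Open; believed false — it
would be a Galerkin-ensemble "no zeroth law" at SOS degree 4.) [folklore] -/
theorem not_quarticGate_iff :
    ¬ QuarticGate ↔ ∀ f : UnitAddTorus (Fin 3) → EuclideanSpace ℝ (Fin 3),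
      Torus.IsSmooth f → Torus.IsDivFree f → Torus.HasZeroMean f →
      ∀ (ν : ℕ → ℝ) (E ε : ℝ), (∀ j, 0 < ν j) → Tendsto ν atTop (𝓝 0) → 0 < ε →
      ∃ j : ℕ, ∀ᶠ N in atTop, ∀ μ, ¬ IsQuarticWitness f (ν j) N E ε μ := by
  rw [quarticGate_iff]
  simp only [not_exists, not_and, not_forall, Filter.not_frequently]

/-- The order-`d` shadow of a witness: a `d'`-stationary law is `d`-stationary for `d ≤ d'`. [folklore] -/
theorem IsPolyStationary.mono {ν : ℝ} {f : UnitAddTorus (Fin 3) → EuclideanSpace ℝ (Fin 3)} {N d d' : ℕ}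
    {μ : Measure (Torus.energySpace (Fin 3))} (h : IsPolyStationary ν f N d' μ) (hd : d ≤ d') :
    IsPolyStationary ν f N d μ :=
  fun m g P hg hP => h m g P hg (hP.trans hd)

/-- The ORDER-3 SHADOW of the crux (3-stationarity, finite fourth moments kept): `QuarticGate` implies
it trivially, so any kill of the shadow — a quietness certificate using rows of degree `≤ 2` only,
i.e. linear rows + the two quadratic Casimir rows (energy, helicity) in 3-D — kills the crux. In 2-D the
enstrophy row is such a certificate (`PlanarCubicQuiet`); in 3-D none is known (`CubicParityLoud`). -/
def CubicShadow : Prop :=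
  ∃ f : UnitAddTorus (Fin 3) → EuclideanSpace ℝ (Fin 3),
    Torus.IsSmooth f ∧ Torus.IsDivFree f ∧ Torus.HasZeroMean f ∧
    ∃ (ν : ℕ → ℝ) (E ε : ℝ), (∀ j, 0 < ν j) ∧ Tendsto ν atTop (𝓝 0) ∧ 0 < ε ∧
    ∀ j : ℕ, ∃ᶠ N in atTop, ∃ μ : Measure (Torus.energySpace (Fin 3)),
      IsProbabilityMeasure μ ∧ (∀ᵐ u ∂μ, IsLevel N u) ∧
      Integrable (fun u : Torus.energySpace (Fin 3) => ‖u‖ ^ 4) μ ∧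
      IsPolyStationary (ν j) f N 3 μ ∧ Torus.ensembleEnergy μ ≤ E ∧ ε ≤ Torus.ensembleDissipation (ν j) μ

/-- `QuarticGate → CubicShadow`. [folklore] -/
theorem cubicShadow_of_quarticGate (h : QuarticGate) : CubicShadow := by
  obtain ⟨f, hfs, hfd, hfz, ν, E, ε, hν, hν0, hε, hj⟩ := quarticGate_iff.1 h
  refine ⟨f, hfs, hfd, hfz, ν, E, ε, hν, hν0, hε, fun j => (hj j).mono ?_⟩
  rintro N ⟨μ, hp, hl, h4, hst, hE, hD⟩
  exact ⟨μ, hp, hl, h4, hst.mono (by norm_num), hE, hD⟩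

end Shape

end

end Summit.AnomalousDissipation.AnomalousDissipation.Theorems.QuarticGate.Negative
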